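import Summits.ValiantsHypothesis.ValiantsHypothesis.Theorems.SymPencilPerFourInnerRankTenPairs
import Summits.ValiantsHypothesis.ValiantsHypothesis.Theorems.SymPencilPerFourHessianMinors
import Summits.ValiantsHypothesis.ValiantsHypothesis.Theorems.SymPencilPerFourPairingDiscTools

/-!
# Route `SymPencil` — inner rank of the `2 | 2` row split of `per_4`: a scalar block is zero or
# isotropic and orthogonal to the neighbouring blocks
# (`--supports` stmt-ValiantsHypothesis-5674 `SdcSuperquadratic`; (8,8) column, isotropic-kernel
# route, first half of the normal-form analysis of memo `NOTE-p6g15-5674-IR12-reduction.md` §3/§11)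

**Theorem** (`scalar_block_dichotomy`).  Let `Σ_r c_r t_r((a,b),(y₂,y₃))² = per (a; b; y₂; y₃)`
(characteristic `0`, any number of squares) and suppose the `y₂`-block of the `a`-part is
scalar: `(t_r((a,0),(x,0)))_r ∈ K v₀` for all `a, x` (first alternative of
`NormalForm.normalForm`).  Then either this block vanishes identically, or `v₀` is isotropic
(`Σ c_r v₀_r² = 0`) and orthogonal (for `diag(c)`) to every `t((a,0),(0,y))` and every
`t((0,b),(x,0))`.  (From `per (a; 0; ·; ·) = 0`, `per (a; b; x; 0) = 0`, polarisation, and a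
generic-`a` cancellation via `SymPencilPerFourHessianMinors.forall_eq_zero_or_of_mul₃`.)

Use: the step "normal form ⇒ pure or peeled" (memo §11).  Honest framing: conditional reduction
machinery for the cells `(8,8,10)`, `(8,8,11)`; nothing about the window, the crux or `VP ≠ VNP`.
No definitions, no named facts. [folklore]
-/

noncomputable section

-- single-conjunct layout: Sub = Summit, duplicated namespace component intended
set_option linter.dupNamespace false

namespace Summit.ValiantsHypothesis.ValiantsHypothesis.Theorems.SymPencilPerFourInnerRankScalarBlock

open Matrix Finset Module
open Summit.ValiantsHypothesis.ValiantsHypothesis.Theorems.SymPencilPerFourInnerRankRows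
open Summit.ValiantsHypothesis.ValiantsHypothesis.Theorems.SymPencilPerFourInnerRankTenFamily
open Summit.ValiantsHypothesis.ValiantsHypothesis.Theorems.SymPencilPerFourHessianMinors
open Summit.ValiantsHypothesis.ValiantsHypothesis.Theorems.SymPencilPerFourPairingDiscTools

variable {K : Type*} [Field K] {ι : Type*} [Fintype ι]

/-- **A scalar `y₂`-block of the `a`-part is zero, or isotropic and orthogonal to the
neighbouring blocks.**  See the module docstring. [folklore] -/
theorem scalar_block_dichotomy [CharZero K] (c : ι → K)
    (t : ι → (((Fin 4 → K) × (Fin 4 → K)) →ₗ[K] ((Fin 4 → K) × (Fin 4 → K)) →ₗ[K] K))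
    (hJ : ∀ a b y₂ y₃ : Fin 4 → K,
      ∑ r, c r * (t r (a, b) (y₂, y₃)) ^ 2 = (Matrix.of ![a, b, y₂, y₃]).permanent)
    (v₀ : ι → K) (hv₀ : ∀ (a x : Fin 4 → K), ∃ s : K, (fun r => t r (a, 0) (x, 0)) = s • v₀) :
    (∀ (a x : Fin 4 → K) r, t r (a, 0) (x, 0) = 0) ∨
    ((∑ r, c r * v₀ r ^ 2 = 0) ∧
      (∀ (a y : Fin 4 → K), ∑ r, c r * v₀ r * t r (a, 0) (0, y) = 0) ∧
      (∀ (b x : Fin 4 → K), ∑ r, c r * v₀ r * t r (0, b) (x, 0) = 0)) := by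
  classical
  by_cases hz : ∀ (a x : Fin 4 → K) r, t r (a, 0) (x, 0) = 0
  · exact Or.inl hz
  right
  push Not at hz
  obtain ⟨a₁, x₁, r₁, h₁⟩ := hz
  obtain ⟨s₁, hs₁⟩ := hv₀ a₁ x₁
  have hs₁r : ∀ r, t r (a₁, 0) (x₁, 0) = s₁ * v₀ r := fun r => by
    have := congr_fun hs₁ r; simpa using this
  have hs₁0 : s₁ ≠ 0 := fun h => h₁ (by rw [hs₁r, h, zero_mul])
  obtain ⟨r₀, hr₀⟩ : ∃ r, v₀ r ≠ 0 := ⟨r₁, fun h => h₁ (by rw [hs₁r, h, mul_zero])⟩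
  -- the scalar `s(a,x) = t_{r₀}((a,0),(x,0)) / v₀ r₀`
  have hsc : ∀ (a x : Fin 4 → K) r, t r (a, 0) (x, 0) = t r₀ (a, 0) (x, 0) / v₀ r₀ * v₀ r := by
    intro a x r
    obtain ⟨s, hs⟩ := hv₀ a x
    have h0 := congr_fun hs r₀; have hr := congr_fun hs r
    simp only [Pi.smul_apply, smul_eq_mul] at h0 hr
    rw [hr, h0]; field_simp
  have h10 : t r₀ (a₁, 0) (x₁, 0) ≠ 0 := by
    rw [hs₁r]; exact mul_ne_zero hs₁0 hr₀
  -- (i) `v₀` is isotropic: `per (a₁; 0; x₁; 0) = 0`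
  have hQ : ∑ r, c r * v₀ r ^ 2 = 0 := by
    have h := hJ a₁ 0 x₁ 0
    rw [per_zero_row₃] at h
    simp_rw [hs₁r] at h
    have : ∑ r, c r * (s₁ * v₀ r) ^ 2 = s₁ ^ 2 * ∑ r, c r * v₀ r ^ 2 := by
      rw [Finset.mul_sum]; exact Finset.sum_congr rfl fun r _ => by ring
    rw [this] at h
    exact (mul_eq_zero.1 h).resolve_left (pow_ne_zero 2 hs₁0)
  refine ⟨hQ, ?_, ?_⟩
  · -- (ii) `v₀ ⟂ t((a,0),(0,y))`: polarisation of `per (a; 0; x₁; y) = 0`, generic in `a`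
    intro a y
    have hprod : ∀ a : Fin 4 → K,
        t r₀ (a, 0) (x₁, 0) * ∑ r, c r * v₀ r * t r (a, 0) (0, y) = 0 := by
      intro a
      have h := polar c t hJ a 0 x₁ 0 0 y
      have hz1 : (Matrix.of ![a, (0 : Fin 4 → K), x₁, y]).permanent = 0 := by
        rw [permanent_of_rows]; simp
      rw [hz1, per_zero_row₃, add_zero] at h
      obtain ⟨s, hs⟩ := hv₀ a x₁
      have hsr : ∀ r, t r (a, 0) (x₁, 0) = s * v₀ r := fun r => by
        have := congr_fun hs r; simpa using this
      simp_rw [hsr] at h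
      have : ∑ r, c r * (s * v₀ r) * t r (a, 0) (0, y) =
          s * ∑ r, c r * v₀ r * t r (a, 0) (0, y) := by
        rw [Finset.mul_sum]; exact Finset.sum_congr rfl fun r _ => by ring
      rw [this] at h
      have h' : s * ∑ r, c r * v₀ r * t r (a, 0) (0, y) = 0 := by linear_combination h / 2
      rcases mul_eq_zero.1 h' with h0 | h0
      · rw [hsr, h0, zero_mul, zero_mul]
      · rw [h0, mul_zero]
    -- both factors are linear in `a`; the first is non-zero at `a₁`
    have hlin₁ : ∀ y₀ y' : Fin 4 → K, ∃ p : Polynomial K, ∀ s : K,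
        (fun a : Fin 4 → K => t r₀ (a, 0) (x₁, 0)) (y₀ + s • y') = p.eval s := by
      intro y₀ y'
      refine ⟨Polynomial.C (t r₀ (y₀, 0) (x₁, 0)) + Polynomial.C (t r₀ (y', 0) (x₁, 0)) *
        Polynomial.X, fun s => ?_⟩
      have : ((y₀ + s • y', (0 : Fin 4 → K)) : (Fin 4 → K) × (Fin 4 → K)) =
          (y₀, 0) + s • (y', 0) := by simp
      simp only [this, map_add, map_smul, LinearMap.add_apply, LinearMap.smul_apply, smul_eq_mul,
        Polynomial.eval_add, Polynomial.eval_mul, Polynomial.eval_C, Polynomial.eval_X]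
      ring
    have hlin₂ : ∀ y₀ y' : Fin 4 → K, ∃ p : Polynomial K, ∀ s : K,
        (fun a : Fin 4 → K => ∑ r, c r * v₀ r * t r (a, 0) (0, y)) (y₀ + s • y') = p.eval s := by
      intro y₀ y'
      refine ⟨Polynomial.C (∑ r, c r * v₀ r * t r (y₀, 0) (0, y)) +
        Polynomial.C (∑ r, c r * v₀ r * t r (y', 0) (0, y)) * Polynomial.X, fun s => ?_⟩
      have : ((y₀ + s • y', (0 : Fin 4 → K)) : (Fin 4 → K) × (Fin 4 → K)) =
          (y₀, 0) + s • (y', 0) := by simp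
      simp only [this, map_add, map_smul, LinearMap.add_apply, LinearMap.smul_apply, smul_eq_mul,
        Polynomial.eval_add, Polynomial.eval_mul, Polynomial.eval_C, Polynomial.eval_X]
      rw [Finset.sum_mul, ← Finset.sum_add_distrib]
      exact Finset.sum_congr rfl fun r _ => by ring
    rcases forall_eq_zero_or_of_mul₃ ⊤ hlin₁ hlin₂ (fun y₀ y' => linePoly_const (1 : K) y₀ y')
        (fun a _ => by
          show t r₀ (a, 0) (x₁, 0) * (∑ r, c r * v₀ r * t r (a, 0) (0, y)) * 1 = 0
          rw [mul_one]; exact hprod a) with h | h | h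
    · exact absurd (h a₁ Submodule.mem_top) h10
    · exact h a Submodule.mem_top
    · exact absurd (h 0 Submodule.mem_top) one_ne_zero
  · -- (iii) `v₀ ⟂ t((0,b),(x,0))`: from `per (a; b; x; 0) = 0`
    intro b x
    -- the `b`-part is isotropic
    have hQb : ∀ x : Fin 4 → K, ∑ r, c r * (t r (0, b) (x, 0)) ^ 2 = 0 := fun x => by
      have h := hJ 0 b x 0; rwa [per_zero_row₀] at h
    have hprod : ∀ (a x : Fin 4 → K),
        t r₀ (a, 0) (x, 0) * ∑ r, c r * v₀ r * t r (0, b) (x, 0) = 0 := by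
      intro a x
      have h := hJ a b x 0
      rw [per_zero_row₃] at h
      have hu : ((a, b) : (Fin 4 → K) × (Fin 4 → K)) = (a, 0) + (0, b) := by simp
      have hsplit : ∀ r, t r (a, b) (x, 0) =
          t r₀ (a, 0) (x, 0) / v₀ r₀ * v₀ r + t r (0, b) (x, 0) := fun r => by
        rw [hu, map_add, LinearMap.add_apply, hsc a x r]
      simp_rw [hsplit] at h
      have hexp : ∑ r, c r * (t r₀ (a, 0) (x, 0) / v₀ r₀ * v₀ r + t r (0, b) (x, 0)) ^ 2 =
          (t r₀ (a, 0) (x, 0) / v₀ r₀) ^ 2 * ∑ r, c r * v₀ r ^ 2 +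
          2 * (t r₀ (a, 0) (x, 0) / v₀ r₀) * ∑ r, c r * v₀ r * t r (0, b) (x, 0) +
          ∑ r, c r * (t r (0, b) (x, 0)) ^ 2 := by
        rw [Finset.mul_sum, Finset.mul_sum, ← Finset.sum_add_distrib, ← Finset.sum_add_distrib]
        exact Finset.sum_congr rfl fun r _ => by ring
      rw [hexp, hQ, hQb x, mul_zero, zero_add, add_zero] at h
      have h' : t r₀ (a, 0) (x, 0) / v₀ r₀ * ∑ r, c r * v₀ r * t r (0, b) (x, 0) = 0 := by
        linear_combination h / 2
      rcases mul_eq_zero.1 h' with h0 | h0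
      · rw [div_eq_zero_iff] at h0
        rcases h0 with h0 | h0
        · rw [h0, zero_mul]
        · exact absurd h0 hr₀
      · rw [h0, mul_zero]
    -- `F(x) := Σ c v₀ t((0,b),(x,0))` is linear and vanishes wherever some `t_{r₀}((a,0),(x,0)) ≠ 0`
    have hF : ∀ x : Fin 4 → K, (∃ a, t r₀ (a, 0) (x, 0) ≠ 0) →
        ∑ r, c r * v₀ r * t r (0, b) (x, 0) = 0 := by
      rintro x ⟨a, ha⟩
      exact (mul_eq_zero.1 (hprod a x)).resolve_left ha
    have hFlin : ∀ x x' : Fin 4 → K, ∑ r, c r * v₀ r * t r (0, b) (x + x', 0) =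
        ∑ r, c r * v₀ r * t r (0, b) (x, 0) + ∑ r, c r * v₀ r * t r (0, b) (x', 0) := by
      intro x x'
      have : ((x + x', (0 : Fin 4 → K)) : (Fin 4 → K) × (Fin 4 → K)) = (x, 0) + (x', 0) := by simp
      rw [this, ← Finset.sum_add_distrib]
      exact Finset.sum_congr rfl fun r _ => by rw [map_add]; ring
    by_cases hx : ∃ a, t r₀ (a, 0) (x, 0) ≠ 0
    · exact hF x hx
    · push Not at hx
      -- `x + x₁` is good (else `x₁` would be bad)
      have hgood : ∃ a, t r₀ (a, 0) (x + x₁, 0) ≠ 0 := by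
        refine ⟨a₁, ?_⟩
        have : ((x + x₁, (0 : Fin 4 → K)) : (Fin 4 → K) × (Fin 4 → K)) = (x, 0) + (x₁, 0) := by
          simp
        rw [this, map_add, hx a₁, zero_add]
        exact h10
      have h1 := hF _ hgood
      have h2 := hF x₁ ⟨a₁, h10⟩
      rw [hFlin, h2, add_zero] at h1
      exact h1

end Summit.ValiantsHypothesis.ValiantsHypothesis.Theorems.SymPencilPerFourInnerRankScalarBlock

end
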